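import Literature.Computability.AlgebraicComplexity.IMMInVPProofs
import Mathlib.RingTheory.MvPolynomial.Symmetric.Defs
import Mathlib.Algebra.MvPolynomial.Monad
import HarnessLib

/-!
# Small (monotone) circuits for the elementary symmetric polynomials — the dynamic programme

Topic `Computability/AlgebraicComplexity`, namespace `Literature.Computability.AlgebraicComplexity`.
Everything PROVED; no named facts, no new definitions.

**Theorem** (folklore — the "dynamic programming" circuit for
`e_k(y_1, …, y_m) = Σ_{|S| = k} Π_{i ∈ S} y_i` built on the recurrence
`e_r(y_1..y_i) = e_r(y_1..y_{i-1}) + y_i · e_{r-1}(y_1..y_{i-1})`, which uses only `+` and `×`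
with coefficients `1`): over ANY commutative semiring `R` — in particular over `ℝ≥0`, i.e. by
MONOTONE circuits — `L(e_k(y_1, …, y_m)) ≤ 2 (k + 1) m` in the tree's fan-in-two measure
`complexity` (`ArithCircuit.lean`, Bürgisser's `L` up to a factor `≤ 3`):
`complexity_esymm_le : complexity (MvPolynomial.esymm σ R k) ≤ 2 * (k + 1) * Fintype.card σ`.
(Context, not used: over infinite fields the elementary symmetric polynomials even have
depth-3 circuits of quadratic size by interpolation from `Π_i (t + y_i)`, with a matching lower
bound — Shpilka–Wigderson 2001, as recalled in Dawar–Wilsenach 2025, §3.3, p. 10; that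
construction divides by Vandermonde determinants and is not monotone.)

## Proof — sharing through substitution (Bürgisser 2000, Rem. 2.7)

The tree's `complexity` is a single-output measure, so the `(k+1) × m` table of the dynamic
programme cannot be kept as separate outputs. As in `IMMInVPProofs.lean` (iterated matrix product)
the table is folded into ONE polynomial with state variables `Z_0, …, Z_k`:
`S_i := Σ_{j ≤ k} Z_j · e_{k-j}(y_i, …, y_{m-1})` (variables `Fin (k+1) ⊕ Fin m`). Then
`S_m = Z_k`, and `S_i` is obtained from `S_{i+1}` by the SUBSTITUTION
`Z_j ↦ Z_j + y_i Z_{j-1}` (`Z_{-1} := 0`), `y ↦ y` — this is the recurrence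
`e_r(y_i, T) = e_r(T) + y_i e_{r-1}(T)` (`esymmMultiset_cons_succ`) read as a transfer step
(`esymm_transfer_step`). By the substitution bound `L(f(g)) ≤ L(f) + Σ L(g_v)`
(`complexity_aeval_le`) each step costs `≤ 2 (k+1)` gates (`Z_j + y_i Z_{j-1}`: one product, one
sum), so `L(S_0) ≤ 2 (k+1) m`; finally `e_k = S_0[Z_0 := 1, Z_{j>0} := 0]`, a free substitution.

Corollaries: the substitution form `complexity_aeval_esymm_le`
(`L(e_k(g_1, …, g_m)) ≤ 2(k+1)m + Σ L(g_i)`), its `bind₁` spelling, and the matrix-symmetric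
instance consumed by crux `MonotoneRestorationQP` of route MonotoneRestoration, summit
ValiantsHypothesis (stub `stub_esymmRowSums_complexity`, the witness family of its Theorem γ):
`e_d` of the ROW SUMS of an `ι × κ` matrix of variables has complexity
`≤ 2 (d+1) |ι| + |ι| |κ|` (`complexity_esymm_rowSums_le`), over every commutative semiring.

`lean search` (2026-08-17): no `complexity`/circuit bound for `esymm` in the tree or Mathlib.
Mathlib has no `Multiset.esymm_cons`; the recurrence and `e_0 = 1` are also proved, for the Hecke
series of `GL_n`, as `Literature.NumberTheory.Automorphic.multiset_esymm_cons_succ` /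
`multiset_esymm_zero_right` (`HeckeLatticeCount.lean`) — restated here under distinct names
(`esymmMultiset_cons_succ`, `esymmMultiset_zero_eq_one`; plus `esymmMultiset_nil_succ` and the
naturality `map_esymmMultiset`) so as not to pull the automorphic import closure into
`Computability/AlgebraicComplexity`.

## References

* [Burgisser2000] P. Bürgisser, *Completeness and Reduction in Algebraic Complexity Theory*,
  Springer 2000, Def. 2.1 (the measure `L`), Rem. 2.7 (substitution) — via `ArithCircuit.lean` and
  `IMMInVPProofs.lean` (`complexity_aeval_le`).
* [DawarWilsenach2025] A. Dawar, G. Wilsenach, *Symmetric arithmetic circuits*, Theory of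
  Computing 21 (2025), §3.3, p. 10 (circuits for the elementary symmetric polynomials; context).
* [ShpilkaWigderson2001] A. Shpilka, A. Wigderson, *Depth-3 arithmetic circuits over fields of
  characteristic zero*, Comput. Complexity 10 (2001) 1–27 (quadratic depth-3 bounds for `e_k`;
  context).
-/

noncomputable section

namespace Literature.Computability.AlgebraicComplexity

open MvPolynomial Finset

universe u v w

/-! ### Identities for `Multiset.esymm` -/

section MultisetEsymm

variable {A : Type u} {B : Type v} [CommSemiring A] [CommSemiring B]

/-- The recurrence of the elementary symmetric functions:
`e_{n+1}(a, s) = e_{n+1}(s) + a · e_n(s)`. [folklore] -/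
theorem esymmMultiset_cons_succ (a : A) (s : Multiset A) (n : ℕ) :
    (a ::ₘ s).esymm (n + 1) = s.esymm (n + 1) + a * s.esymm n := by
  simp only [Multiset.esymm, Multiset.powersetCard_cons, Multiset.map_add, Multiset.sum_add,
    Multiset.map_map, Function.comp_def, Multiset.prod_cons]
  rw [Multiset.sum_map_mul_left]

/-- `e_0(s) = 1`. [folklore] -/
theorem esymmMultiset_zero_eq_one (s : Multiset A) : s.esymm 0 = 1 := by
  simp [Multiset.esymm, Multiset.powersetCard_zero_left]

/-- `e_{n+1}(∅) = 0`. [folklore] -/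
theorem esymmMultiset_nil_succ (n : ℕ) : (0 : Multiset A).esymm (n + 1) = 0 := by
  simp [Multiset.esymm]

/-- Naturality of the elementary symmetric functions under (semi)ring homomorphisms:
`f (e_n(s)) = e_n(f(s))`. [folklore] -/
theorem map_esymmMultiset {F : Type w} [FunLike F A B] [RingHomClass F A B] (f : F)
    (s : Multiset A) (n : ℕ) : f (s.esymm n) = (s.map f).esymm n := by
  simp only [Multiset.esymm, map_multiset_sum, Multiset.map_map, Function.comp_def,
    map_multiset_prod, Multiset.powersetCard_map]

/-- **The transfer step of the dynamic programme.** With `Z_{-1} := 0`,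
`Σ_{j ≤ k} (Z_j + y Z_{j-1}) · e_{k-j}(T) = Σ_{j ≤ k} Z_j · e_{k-j}(y, T)` — the recurrence
`e_r(y, T) = e_r(T) + y e_{r-1}(T)` summed against arbitrary weights `Z_j`. [folklore] -/
theorem esymm_transfer_step (k : ℕ) (z : ℕ → A) (y : A) (T : Multiset A) :
    ∑ j ∈ range (k + 1), (z j + y * (if j = 0 then 0 else z (j - 1))) * T.esymm (k - j) =
      ∑ j ∈ range (k + 1), z j * (y ::ₘ T).esymm (k - j) := by
  -- right-hand side: split every `e_{k-j}(y, T)`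
  have hR : ∀ j ∈ range (k + 1), z j * (y ::ₘ T).esymm (k - j) =
      z j * T.esymm (k - j) + (if j < k then z j * (y * T.esymm (k - j - 1)) else 0) := by
    intro j hj
    by_cases hjk : j < k
    · have hr : k - j = (k - j - 1) + 1 := by omega
      rw [if_pos hjk, hr, esymmMultiset_cons_succ, Nat.add_sub_cancel, mul_add]
    · have h0 : k - j = 0 := by
        rw [Finset.mem_range] at hj
        omega
      rw [if_neg hjk, h0, esymmMultiset_zero_eq_one, esymmMultiset_zero_eq_one, add_zero]
  rw [Finset.sum_congr rfl hR, Finset.sum_add_distrib]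
  simp_rw [add_mul]
  rw [Finset.sum_add_distrib]
  congr 1
  -- left: drop the vanishing `j = 0` term and shift; right: drop the vanishing `j = k` term
  rw [Finset.sum_range_succ' (fun j => y * (if j = 0 then (0 : A) else z (j - 1)) * T.esymm (k - j)),
    Finset.sum_range_succ (fun j => if j < k then z j * (y * T.esymm (k - j - 1)) else 0)]
  simp only [if_true, mul_zero, zero_mul, add_zero, lt_irrefl, if_false,
    Nat.add_sub_cancel, Nat.succ_ne_zero]
  refine Finset.sum_congr rfl fun j hj => ?_
  rw [Finset.mem_range] at hj
  rw [if_pos hj, show k - (j + 1) = k - j - 1 by omega]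
  ring

end MultisetEsymm

/-! ### The circuit bound -/

section EsymmCircuit

variable {R : Type u} [CommSemiring R]

/-- Substituting into a state polynomial `Σ_j Z_j · e_{k-j}(T)` along a substitution that fixes
the multiset `T`: only the weights move. [folklore] -/
theorem aeval_sum_mul_esymm {V : Type v} {W : Type w} (k : ℕ) (φ : V → MvPolynomial W R)
    (z : ℕ → MvPolynomial V R) (T : Multiset (MvPolynomial V R)) :
    aeval φ (∑ j ∈ range (k + 1), z j * T.esymm (k - j)) =
      ∑ j ∈ range (k + 1), aeval φ (z j) * (T.map (aeval φ)).esymm (k - j) := by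
  simp only [map_sum, map_mul, map_esymmMultiset (aeval φ)]

/-- **Circuits for `e_k` (variables `Fin m`).** Over every commutative semiring,
`L(e_k(y_0, …, y_{m-1})) ≤ 2 (k+1) m` — the dynamic programme, realised as `m` substitutions
`Z_j ↦ Z_j + y_i Z_{j-1}` applied to `Z_k` (`complexity_aeval_le`, Bürgisser Rem. 2.7), followed
by `Z_0 ↦ 1, Z_{j>0} ↦ 0`.
[folklore] -/
theorem complexity_esymm_fin_le (k m : ℕ) :
    complexity (MvPolynomial.esymm (Fin m) R k) ≤ 2 * (k + 1) * m := by
  classical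
  -- costs of variables and constants
  have hX0 : ∀ {W : Type} (w : W), complexity (X w : MvPolynomial W R) = 0 :=
    fun w => complexity_X_holds w
  have hC0 : ∀ {W : Type} (c : R), complexity (C c : MvPolynomial W R) = 0 :=
    fun c => complexity_C_holds c
  -- variables: states `inl j` (`Z_j`), inputs `inr t` (`y_t`)
  obtain ⟨z, hz⟩ : ∃ z : ℕ → MvPolynomial (Fin (k + 1) ⊕ Fin m) R,
      ∀ j, z j = if h : j < k + 1 then X (Sum.inl ⟨j, h⟩) else 0 := ⟨_, fun _ => rfl⟩
  obtain ⟨zp, hzp⟩ : ∃ zp : ℕ → MvPolynomial (Fin (k + 1) ⊕ Fin m) R,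
      ∀ j, zp j = if j = 0 then 0 else z (j - 1) := ⟨_, fun _ => rfl⟩
  -- tails `T i = {y_i, …, y_{m-1}}` and states `S i = Σ_j Z_j e_{k-j}(T i)`
  obtain ⟨T, hT⟩ : ∃ T : ℕ → Multiset (MvPolynomial (Fin (k + 1) ⊕ Fin m) R),
      ∀ i, T i = ((univ : Finset (Fin m)).filter fun t : Fin m => i ≤ t.val).val.map
        fun t => X (Sum.inr t) := ⟨_, fun _ => rfl⟩
  obtain ⟨S, hS⟩ : ∃ S : ℕ → MvPolynomial (Fin (k + 1) ⊕ Fin m) R,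
      ∀ i, S i = ∑ j ∈ range (k + 1), z j * (T i).esymm (k - j) := ⟨_, fun _ => rfl⟩
  -- costs of the building blocks
  have hzlt : ∀ j, j < k + 1 → ∀ h : j < k + 1, z j = X (Sum.inl ⟨j, h⟩) := by
    intro j hj h
    rw [hz, dif_pos hj]
  have hz0 : ∀ j, complexity (z j) = 0 := by
    intro j
    by_cases hj : j < k + 1
    · rw [hzlt j hj hj]; exact hX0 _
    · rw [hz, dif_neg hj, ← C_0]; exact hC0 _
  have hzp0 : ∀ j, complexity (zp j) = 0 := by
    intro j
    by_cases hj : j = 0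
    · rw [hzp, if_pos hj, ← C_0]; exact hC0 _
    · rw [hzp, if_neg hj]; exact hz0 _
  -- (a) structure of the tails
  have hTm : T m = 0 := by
    have h : ((univ : Finset (Fin m)).filter fun t : Fin m => m ≤ t.val) = ∅ :=
      Finset.filter_false_of_mem fun t _ => not_le.2 t.is_lt
    rw [hT, h, Finset.empty_val, Multiset.map_zero]
  have hTcons : ∀ (i : ℕ) (hi : i < m), T i = X (Sum.inr ⟨i, hi⟩) ::ₘ T (i + 1) := by
    intro i hi
    have hsets : ((univ : Finset (Fin m)).filter fun t : Fin m => i ≤ t.val) =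
        insert (⟨i, hi⟩ : Fin m) ((univ : Finset (Fin m)).filter fun t : Fin m => i + 1 ≤ t.val) := by
      ext t
      simp only [Finset.mem_filter, Finset.mem_univ, true_and, Finset.mem_insert, Fin.ext_iff]
      omega
    have hni : (⟨i, hi⟩ : Fin m) ∉ ((univ : Finset (Fin m)).filter fun t : Fin m => i + 1 ≤ t.val) := by
      simp
    rw [hT, hT, hsets, Finset.insert_val_of_notMem hni, Multiset.map_cons]
  -- (b) the last state is `Z_k`
  have hSm : S m = z k := by
    rw [hS, hTm, Finset.sum_range_succ, Nat.sub_self, esymmMultiset_zero_eq_one, mul_one,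
      Finset.sum_eq_zero, zero_add]
    intro j hj
    rw [Finset.mem_range] at hj
    rw [show k - j = (k - j - 1) + 1 by omega, esymmMultiset_nil_succ, mul_zero]
  -- (c) the transfer substitution at row `i`: `Z_j ↦ Z_j + y_i Z_{j-1}`, `y ↦ y`
  obtain ⟨φ, hφ⟩ : ∃ φ : Fin m → Fin (k + 1) ⊕ Fin m → MvPolynomial (Fin (k + 1) ⊕ Fin m) R,
      ∀ i, φ i = Sum.elim (fun j : Fin (k + 1) => z j + X (Sum.inr i) * zp j)
        (fun t => X (Sum.inr t)) := ⟨_, fun _ => rfl⟩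
  have hφl : ∀ (i : Fin m) (j : Fin (k + 1)), φ i (Sum.inl j) = z j + X (Sum.inr i) * zp j := by
    intro i j; rw [hφ, Sum.elim_inl]
  have hφr : ∀ (i t : Fin m), φ i (Sum.inr t) = X (Sum.inr t) := by
    intro i t; rw [hφ, Sum.elim_inr]
  have hφz : ∀ (i : Fin m) (j : ℕ), j < k + 1 →
      aeval (φ i) (z j) = z j + X (Sum.inr i) * zp j := by
    intro i j hj
    nth_rewrite 1 [hzlt j hj hj]
    rw [aeval_X, hφl]
  have hφT : ∀ (i : Fin m) (i' : ℕ), (T i').map (aeval (φ i)) = T i' := by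
    intro i i'
    rw [hT, Multiset.map_map]
    refine Multiset.map_congr rfl fun t _ => ?_
    rw [Function.comp_apply, aeval_X, hφr]
  have hstep : ∀ (i : ℕ) (hi : i < m), aeval (φ ⟨i, hi⟩) (S (i + 1)) = S i := by
    intro i hi
    rw [hS, hS, aeval_sum_mul_esymm k (φ ⟨i, hi⟩) z (T (i + 1)), hφT,
      Finset.sum_congr rfl fun j hj => by rw [hφz _ j (Finset.mem_range.1 hj)],
      hTcons i hi, ← esymm_transfer_step k z (X (Sum.inr ⟨i, hi⟩)) (T (i + 1))]
    refine Finset.sum_congr rfl fun j _ => ?_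
    rw [hzp]
  -- (d) each transfer substitution costs at most `2 (k+1)` gates
  have hcost : ∀ i : Fin m, ∑ v, complexity (φ i v) ≤ 2 * (k + 1) := by
    intro i
    rw [Fintype.sum_sum_type]
    have h1 : ∀ j : Fin (k + 1), complexity (φ i (Sum.inl j)) ≤ 2 := by
      intro j
      rw [hφl]
      calc complexity (z j + X (Sum.inr i) * zp j)
          ≤ complexity (z j) + complexity (X (Sum.inr i) * zp j) + 1 := complexity_add_le_holds _ _
        _ ≤ 0 + (0 + 0 + 1) + 1 := by
            gcongr
            · exact (hz0 j).le
            · calc complexity (X (Sum.inr i) * zp j)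
                  ≤ complexity (X (Sum.inr i) : MvPolynomial (Fin (k + 1) ⊕ Fin m) R) +
                      complexity (zp j) + 1 := complexity_mul_le_holds _ _
                _ ≤ 0 + 0 + 1 := by
                    gcongr
                    · exact (hX0 _).le
                    · exact (hzp0 j).le
        _ = 2 := rfl
    have h2 : ∀ t : Fin m, complexity (φ i (Sum.inr t)) = 0 := fun t => by rw [hφr]; exact hX0 _
    calc ∑ j, complexity (φ i (Sum.inl j)) + ∑ t, complexity (φ i (Sum.inr t))
        ≤ ∑ _j : Fin (k + 1), 2 + ∑ _t : Fin m, 0 :=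
          add_le_add (Finset.sum_le_sum fun j _ => h1 j) (Finset.sum_le_sum fun t _ => (h2 t).le)
      _ = 2 * (k + 1) := by simp [mul_comm]
  -- (e) downward induction on the rows
  have hind : ∀ d : ℕ, d ≤ m → complexity (S (m - d)) ≤ 2 * (k + 1) * d := by
    intro d
    induction d with
    | zero =>
      intro _
      rw [Nat.sub_zero, hSm, hz0]
      exact Nat.zero_le _
    | succ d ih =>
      intro hd
      have hi : m - (d + 1) < m := by omega
      have heq : m - (d + 1) + 1 = m - d := by omega
      rw [← hstep _ hi, heq]
      calc complexity (aeval (φ ⟨m - (d + 1), hi⟩) (S (m - d)))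
          ≤ complexity (S (m - d)) + ∑ v, complexity (φ ⟨m - (d + 1), hi⟩ v) :=
            complexity_aeval_le _ _
        _ ≤ 2 * (k + 1) * d + 2 * (k + 1) := add_le_add (ih (by omega)) (hcost _)
        _ = 2 * (k + 1) * (d + 1) := by ring
  have hS0 : complexity (S 0) ≤ 2 * (k + 1) * m := by
    simpa using hind m le_rfl
  -- (f) read off `e_k`: `Z_0 ↦ 1`, `Z_{j>0} ↦ 0`, `y_t ↦ X t` — a free substitution
  obtain ⟨ψ, hψ⟩ : ∃ ψ : Fin (k + 1) ⊕ Fin m → MvPolynomial (Fin m) R,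
      ψ = Sum.elim (fun j : Fin (k + 1) => if (j : ℕ) = 0 then 1 else 0) (fun t => X t) :=
    ⟨_, rfl⟩
  have hψl : ∀ j : Fin (k + 1), ψ (Sum.inl j) = if (j : ℕ) = 0 then 1 else 0 := by
    intro j; rw [hψ, Sum.elim_inl]
  have hψr : ∀ t : Fin m, ψ (Sum.inr t) = X t := by
    intro t; rw [hψ, Sum.elim_inr]
  have hT0 : (T 0).map (aeval ψ) = (univ : Finset (Fin m)).val.map X := by
    have h : ((univ : Finset (Fin m)).filter fun t : Fin m => 0 ≤ t.val) = univ :=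
      Finset.filter_true_of_mem fun t _ => Nat.zero_le _
    rw [hT, h, Multiset.map_map]
    refine Multiset.map_congr rfl fun t _ => ?_
    rw [Function.comp_apply, aeval_X, hψr]
  have hψS : aeval ψ (S 0) = MvPolynomial.esymm (Fin m) R k := by
    rw [hS, aeval_sum_mul_esymm k ψ z (T 0), hT0, Finset.sum_eq_single 0]
    · rw [hzlt 0 (Nat.zero_lt_succ k) (Nat.zero_lt_succ k), aeval_X, hψl, if_pos rfl, one_mul,
        Nat.sub_zero]
      exact (congrFun (MvPolynomial.esymm_eq_multiset_esymm (Fin m) R) k).symm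
    · intro j hj hj0
      rw [Finset.mem_range] at hj
      rw [hzlt j hj hj, aeval_X, hψl, if_neg hj0, zero_mul]
    · intro h
      exact absurd (Finset.mem_range.2 (Nat.zero_lt_succ k)) h
  have hψcost : ∑ v, complexity (ψ v) = 0 := by
    refine Finset.sum_eq_zero fun v _ => ?_
    rcases v with j | t
    · by_cases hj : (j : ℕ) = 0
      · rw [hψl, if_pos hj, ← C_1]; exact hC0 _
      · rw [hψl, if_neg hj, ← C_0]; exact hC0 _
    · rw [hψr]; exact hX0 _
  calc complexity (MvPolynomial.esymm (Fin m) R k) = complexity (aeval ψ (S 0)) := by rw [hψS]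
    _ ≤ complexity (S 0) + ∑ v, complexity (ψ v) := complexity_aeval_le _ _
    _ ≤ 2 * (k + 1) * m + 0 := add_le_add hS0 hψcost.le
    _ = 2 * (k + 1) * m := add_zero _

/-- **Circuits for the elementary symmetric polynomials.** Over every commutative semiring `R`
(so, for `R = ℝ≥0`, by monotone circuits) and every finite set of variables `σ`,
`L(e_k) ≤ 2 (k + 1) |σ|` in the fan-in-two measure `complexity`.
[folklore] -/
theorem complexity_esymm_le {σ : Type v} [Fintype σ] (k : ℕ) :
    complexity (MvPolynomial.esymm σ R k) ≤ 2 * (k + 1) * Fintype.card σ := by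
  classical
  have h : MvPolynomial.esymm σ R k =
      rename (Fintype.equivFin σ).symm (MvPolynomial.esymm (Fin (Fintype.card σ)) R k) := by
    rw [MvPolynomial.rename_esymm]
  rw [h]
  exact (complexity_rename_le_holds' _ _).trans (complexity_esymm_fin_le k _)

/-- **Substitution form**: `L(e_k(g_1, …, g_m)) ≤ 2 (k+1) m + Σ_i L(g_i)` (the circuit for `e_k`
on top of circuits for the `g_i`; Bürgisser 2000, Rem. 2.7, `complexity_aeval_le`). [folklore] -/
theorem complexity_aeval_esymm_le {σ : Type v} {τ : Type w} [Fintype σ] (k : ℕ)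
    (g : σ → MvPolynomial τ R) :
    complexity (aeval g (MvPolynomial.esymm σ R k)) ≤
      2 * (k + 1) * Fintype.card σ + ∑ i, complexity (g i) :=
  (complexity_aeval_le _ _).trans (Nat.add_le_add_right (complexity_esymm_le k) _)

/-- The same in the `bind₁` spelling of substitution (`MvPolynomial.aeval_eq_bind₁`).
[folklore] -/
theorem complexity_bind₁_esymm_le {σ : Type v} {τ : Type w} [Fintype σ] (k : ℕ)
    (g : σ → MvPolynomial τ R) :
    complexity (bind₁ g (MvPolynomial.esymm σ R k)) ≤
      2 * (k + 1) * Fintype.card σ + ∑ i, complexity (g i) := by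
  rw [← MvPolynomial.aeval_eq_bind₁]
  exact complexity_aeval_esymm_le k g

/-- **`e_d` of the row sums of a matrix of variables** (a matrix-symmetric family, invariant
under independent row and column permutations): over every commutative semiring,
`L(e_d(R_1, …, R_{|ι|})) ≤ 2 (d+1) |ι| + |ι| |κ|`, where
`R_i = Σ_j x_{ij}` (each row sum costs `|κ|` gates, `complexity_finset_sum_le`).
[folklore] -/
theorem complexity_esymm_rowSums_le {ι : Type v} {κ : Type w} [Fintype ι] [Fintype κ] (d : ℕ) :
    complexity (bind₁ (fun i : ι => ∑ j : κ, (X (i, j) : MvPolynomial (ι × κ) R))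
      (MvPolynomial.esymm ι R d)) ≤
      2 * (d + 1) * Fintype.card ι + Fintype.card ι * Fintype.card κ := by
  refine (complexity_bind₁_esymm_le d _).trans (Nat.add_le_add_left ?_ _)
  calc ∑ i : ι, complexity (∑ j : κ, (X (i, j) : MvPolynomial (ι × κ) R))
      ≤ ∑ _i : ι, Fintype.card κ := by
        refine Finset.sum_le_sum fun i _ => ?_
        refine (complexity_finset_sum_le _ _).trans ?_
        rw [Finset.sum_eq_zero fun j _ => complexity_X_holds (k := R) (i, j), zero_add,
          Finset.card_univ]
    _ = Fintype.card ι * Fintype.card κ := by simp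

end EsymmCircuit

end Literature.Computability.AlgebraicComplexity

end
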